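import Literature.MathematicalPhysics.QuantumFieldTheory.Balaban1983to89.B13CentredExpLetters

/-!
# `Balaban1983to89.B13ClippedFieldLetters` — T. Bałaban, *Renormalization group approach to lattice gauge field theories. II.
Cluster expansions*, Commun. Math. Phys. **116** (1988) 1–22 [Balaban1988RG2Cluster], pp. 12, 15–16 (with (1.20) p. 6), and
[Balaban1987RG1] (2.9)–(2.13) pp. 266–268: the DATUM-SIDE INHABITANT of every `∀ B`-letter of the B13 engines
(`B13Bound226Centred`, `B13Bound226BoxTail`, `B13Bound226CentredRem`, `B13Term214WindowDilated`) — the (2.20) letter `h220U` with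
a SMALL rate, the centre's letter `hw₀U`, the exponential-moment Taylor letters `h1eU ∕ h2eU` of `B13CentredExpLetters`, parity
and measurability — from print-SHAPED **LOCAL** growth letters of the unscaled-field law `𝐕_s(Y,B) = s⁻²𝒲(Y,sB) + 𝒪(Y,sB)` on the
sup-ball `‖A‖ ≤ ρ` (print's analyticity domain «g_k|B| < ε₁»), by COORDINATEWISE CLIPPING of the unscaled field inside the law:
`clip ρ A b := max (−ρ) (min ρ (A b))`, `𝐕^π_s(Y,B) := s⁻²𝒲(Y, clip ρ (sB)) + 𝒪(Y, clip ρ (sB))` — a twin family which the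
(2.14) last line `F214` CANNOT DISTINGUISH from the law's (`F214_clip_eq`: the box `χ_{Y₀}` forces `|sB(b)| < ε₁ ≤ ρ` on the
bonds the potentials read)

statement-level skeleton of published theorems with citation tags; proofs where landed; nothing here is a claim about the
Yang–Mills mass gap

PDF held: `paper:balaban1988-cmp116-rg-ii-cluster` (journal page = PDF page + 0), pp. 6, 12, 15–16 (quoted in full in `B13Term214`,
`B13Integral223`, `B13Sect2Statements`); `paper:balaban1987-cmp109-rg-i` pp. 266–268 (render
`b2b-balaban-ref1/pages/1987-cmp109-rg-I-small-field/…-p018∕p019∕p020-x2.png`).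

CITATION HEADER.  [II] p. 12 (2.2)–(2.3): *"Y₀ = ⋃_{Y∈𝐃} Y … P ⊂ Y₀ᶜ"* (shape; quoted in `B13Sect2Statements`); p. 16 L17–27
after (2.20): *"the constant is small for κ₁ large, hence we can bound it by 1; using (1.28) we obtain (2.20)"* — print's (2.20)
is derived ON THE DOMAIN (1.20) p. 6 «… and g_k|B| < ε₁» and used only under `χ_{k,Y₀}`; [I] p. 266 (2.9) *"χ_k = Π_b χ({|B′(b)| <
ε₁})"*, p. 267 after (2.12) *"Next we make the scaling transformation B = g_kB′ …"*.  NOT PRINTED: the clipping device (print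
never needs a global-in-`B` letter: its characteristic functions are in the integrand); what is recorded is that the tree's
`∀ B` typing convenience (`F214 = 0` off `supp χ_{Y₀}`) is met EXACTLY by the clipped twin, from print's local regime.

PROVENANCE.  §1–§4 (except the two compositions `h1eU_clip`, `h2eU_clip` of §4, typed here) are a PORT WITH PROVENANCE of the
memo-only lens seat's sketch `run/shared/lean/pub/pub-ymgap/ym-lens-BalabanUVNodes-transfer/lean/LensTransferSketch15.lean`
(sha16 a64747e141cc47d3, namespace `YMLens.Transfer15`, seat `ym-lens-BalabanUVNodes-transfer` g15, Card T27 + demand d13′ of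
`LENS-transfer.md` §21; bus `run/shared/lean/pub/pub-ymgap/INBOX.md` l.≈19578: *«port with or without credit — the lens files
nothing … Sketch15's `pi_norm_sq_le_dotProduct`∕`odd_of_homogeneous` copies are redundant on port (cite `B13CentredExpLetters.*`)»*):
statements and proofs are the lens's, re-homed under `Literature` so that tree files can import them (decl blocks identical
modulo namespace, header, docstrings, the two cited duplicates dropped), each docstring saying so.  Cell `pub-ymgap`, seat
`pub-ymgap-dag-n10-c` (g7), node N10 [B13]; consumers: node N22's J6∕J7 (`Summits/…/BalabanUVNodesN22W1RelCentred…`, the letters of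
the member of the datum), the unseated N09 ∕ Lemma-2 successor (the junction at the W1 datum: keep the datum on the UNclipped law,
form the clipped twin at the junction, transport by `F214_clip_eq`); producer of the LOCAL letters: the W1 datum's growth schema
(definer, demand d13′).

WHAT IS HERE (five definitions: `clip`, `Vclip`, `Vlaw`, `V₀`, `V₁`; no structure ∕ class ∕ instance).
* §1 COORDINATEWISE CLIPPING `clip ρ A` and its algebra: `|clip| ≤ ρ`, `|clip| ≤ |A|`, identity on small coordinates ∕ on the
  sup-ball, `clip ρ 0 = 0`, PARITY `clip ρ (−A) = −clip ρ A`, congruence on a coordinate set, continuity ∕ measurability.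
* §2 LOCAL growth letters on the sup-ball ⇒ the GLOBAL letters of `B13CentredExpLetters` §4 for the clipped functions:
  `cubic_global_of_local` (G1), `h220_clip_pointwise` (‖s⁻²𝒲(clip ρ (sB))‖ ≤ c₃ρ·B·B for ALL `B`, ALL `s > 0`),
  `quartic_global_of_local` (G2: constant `c₄ + (c₃+c₃′)/ρ`), `linear_global_of_local` (G4), `quadratic_global_of_local`
  (G5: `c₂ + (c₁+c₁′)/ρ`).
* §3 THE CLIPPED MEMBER `Vclip`, the law's member `Vlaw`, the centre `V₀ := 𝒪(·,0)` (even, `rfl`), the odd part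
  `V₁ := s(𝒲₃ + D𝒪)` (`V₁_odd` via `B13CentredExpLetters.odd_of_homogeneous`), measurability; `F214_congr_on_support`,
  `Vclip_eq_Vlaw_on_support`, `F214_clip_eq` (F214 DOES NOT SEE THE CLIPPING, under the box-support and `Y`-locality
  hypotheses), `member_congr_on_support`, `Vclip_eq_Vlaw_of_norm_le`; the engines' letters on a bounded per-domain τ-region:
  `hw₀U_clip` (`w₀ = R|𝐃|c₀`), `h220U_clip` (`a₂₀ = 2R|𝐃|c₃ρ`, `w = R|𝐃|(c₀ + c₁ρ)`).
* §4 THE BRIDGES `Vclip_sub_V₀`, `Vclip_sub_V₀_sub_V₁`, the bundle `globalLetters_of_local`, and the COMPOSITIONS (typed here)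
  `h1eU_clip`, `h2eU_clip`: the exponential Taylor letters of `B13Bound226CentredRem.…_of_primitives_exp` for the clipped twin,
  `s`-FREE constants `K₁ = R|𝐃|(c₃(3/(eδ))³ + c₁/(eδ))e^{δ/2}`, `K₂ = R|𝐃|((c₄+(c₃+c₃′)/ρ)(4/(eδ))⁴ + (c₂+(c₁+c₁′)/ρ)(2/(eδ))²)e^{δ/2}`,
  any rate `δ > 0`, via `B13CentredExpLetters.firstOrder∕secondOrder_unscaled_gauss`.
HONEST SCOPE.  Folklore real analysis + bookkeeping; no estimate of Bałaban's.  The LOCAL growth letters (L0)–(L6), the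
box-support hypothesis `χ_{Y₀}(B) ≠ 0 → ∀ b ∈ S₀, |sB(b)| ≤ ρ` and the `Y`-locality of `𝒲(Y,·)`, `𝒪(Y,·)` are the PRODUCER's
data about the datum ([I] (2.9)–(2.13), [II] (2.2)–(2.3)) — hypotheses here; the functions are GENERIC
(`𝒲 𝒪 𝒲₃ D𝒪 : D → (Λ → ℝ) → ℂ`, no W1 object is read).  No landed module changes; N10∕N22∕N09 NOT discharged.  No `sorry`,
no instance, no new named fact (D-0026).
-/

noncomputable section

namespace Literature.MathematicalPhysics.QuantumFieldTheory.Balaban1983to89.B13ClippedFieldLetters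

open Matrix MeasureTheory Finset Complex Metric Set
open scoped Real
open B13Term214 (F214)
open B13CentredExpLetters (pi_norm_sq_le_dotProduct odd_of_homogeneous firstOrder_unscaled_gauss secondOrder_unscaled_gauss)

variable {Λ : Type} [Fintype Λ]
variable {D : Type*}

/-! ## §1. Coordinatewise clipping of the unscaled field (lens Sketch15 §P) -/

omit [Fintype Λ] in
/-- **Coordinatewise clipping at radius `ρ`** (lens Sketch15 `clip`): `clip ρ A b = max (−ρ) (min ρ (A b))` — the unscaled
field `A = sB` cut back, coordinate by coordinate, into print's small-field box ([I] (2.9) «χ({|B′(b)| < ε₁})», [II] (1.20)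
«g_k|B| < ε₁»). [cite: Balaban1987RG1, (2.9) p.266; Balaban1988RG2Cluster, (1.20) p.6] -/
def clip (ρ : ℝ) (A : Λ → ℝ) : Λ → ℝ := fun b => max (-ρ) (min ρ (A b))

omit [Fintype Λ] in
/-- Unfolding `clip` at a coordinate (lens Sketch15 `clip_apply`). [cite: Balaban1987RG1, (2.9) p.266] (elementary API for the small-field box) -/
theorem clip_apply (ρ : ℝ) (A : Λ → ℝ) (b : Λ) : clip ρ A b = max (-ρ) (min ρ (A b)) := rfl

omit [Fintype Λ] in
/-- `|clip ρ A b| ≤ ρ` (lens Sketch15 `abs_clip_le`). [cite: Balaban1987RG1, (2.9) p.266] (elementary API for the small-field box) -/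
theorem abs_clip_le {ρ : ℝ} (hρ : 0 ≤ ρ) (A : Λ → ℝ) (b : Λ) : |clip ρ A b| ≤ ρ := by
  rw [clip_apply, abs_le]
  exact ⟨le_max_left _ _, max_le (by linarith) (min_le_left _ _)⟩

omit [Fintype Λ] in
/-- `|clip ρ A b| ≤ |A b|` (lens Sketch15 `abs_clip_le_abs`). [cite: Balaban1987RG1, (2.9) p.266] (elementary API for the small-field box) -/
theorem abs_clip_le_abs {ρ : ℝ} (hρ : 0 ≤ ρ) (A : Λ → ℝ) (b : Λ) : |clip ρ A b| ≤ |A b| := by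
  rw [clip_apply]
  rcases le_total (A b) ρ with h | h
  · rw [min_eq_right h]
    rcases le_total (-ρ) (A b) with h' | h'
    · rw [max_eq_right h']
    · rw [max_eq_left h', abs_of_nonpos (by linarith : -ρ ≤ 0), abs_of_nonpos (by linarith : A b ≤ 0)]
      linarith
  · rw [min_eq_left h, max_eq_right (by linarith : -ρ ≤ ρ), abs_of_nonneg hρ, abs_of_nonneg (hρ.trans h)]
    exact h

omit [Fintype Λ] in
/-- On a small coordinate the clipping does nothing: `|A b| ≤ ρ → clip ρ A b = A b` (lens Sketch15 `clip_apply_of_abs_le`).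
[cite: Balaban1987RG1, (2.9) p.266] (elementary API for the small-field box) -/
theorem clip_apply_of_abs_le {ρ : ℝ} {A : Λ → ℝ} {b : Λ} (h : |A b| ≤ ρ) : clip ρ A b = A b := by
  rw [abs_le] at h
  rw [clip_apply, min_eq_right h.2, max_eq_right h.1]

/-- `‖clip ρ A‖ ≤ ρ` (sup norm; lens Sketch15 `norm_clip_le`). [cite: Balaban1987RG1, (2.9) p.266] (elementary API for the small-field box) -/
theorem norm_clip_le {ρ : ℝ} (hρ : 0 ≤ ρ) (A : Λ → ℝ) : ‖clip ρ A‖ ≤ ρ :=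
  (pi_norm_le_iff_of_nonneg hρ).2 fun b => by rw [Real.norm_eq_abs]; exact abs_clip_le hρ A b

/-- `‖clip ρ A‖ ≤ ‖A‖` (sup norm; lens Sketch15 `norm_clip_le_norm`). [cite: Balaban1987RG1, (2.9) p.266] (elementary API for the small-field box) -/
theorem norm_clip_le_norm {ρ : ℝ} (hρ : 0 ≤ ρ) (A : Λ → ℝ) : ‖clip ρ A‖ ≤ ‖A‖ :=
  (pi_norm_le_iff_of_nonneg (norm_nonneg A)).2 fun b => by
    rw [Real.norm_eq_abs]
    exact (abs_clip_le_abs hρ A b).trans (by simpa [Real.norm_eq_abs] using norm_le_pi_norm A b)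

/-- Inside the sup-ball the clipping is the identity: `‖A‖ ≤ ρ → clip ρ A = A` (lens Sketch15 `clip_eq_self_of_norm_le`).
[cite: Balaban1987RG1, (2.9) p.266] (elementary API for the small-field box) -/
theorem clip_eq_self_of_norm_le {ρ : ℝ} {A : Λ → ℝ} (h : ‖A‖ ≤ ρ) : clip ρ A = A :=
  funext fun b => clip_apply_of_abs_le ((by simpa [Real.norm_eq_abs] using norm_le_pi_norm A b : |A b| ≤ ‖A‖).trans h)

omit [Fintype Λ] in
/-- `clip ρ 0 = 0` for `ρ ≥ 0` (lens Sketch15 `clip_zero`). [cite: Balaban1987RG1, (2.9) p.266] (elementary API for the small-field box) -/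
theorem clip_zero {ρ : ℝ} (hρ : 0 ≤ ρ) : clip ρ (0 : Λ → ℝ) = 0 :=
  funext fun b => by rw [clip_apply, Pi.zero_apply, min_eq_right hρ, max_eq_right (by linarith : -ρ ≤ 0)]

omit [Fintype Λ] in
/-- **Parity**: `clip ρ (−A) = −clip ρ A` for `ρ ≥ 0` (lens Sketch15 `clip_neg`) — the clipped law keeps the parity mechanism of
`B13Term214Centred`. [cite: Balaban1987RG1, (2.9)–(2.13) pp.266–268] (elementary API for the small-field box) -/
theorem clip_neg {ρ : ℝ} (hρ : 0 ≤ ρ) (A : Λ → ℝ) : clip ρ (-A) = -clip ρ A := by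
  funext b
  simp only [clip_apply, Pi.neg_apply]
  rw [← min_neg_neg, neg_neg, ← max_neg_neg, max_min_distrib_left, max_eq_right (by linarith : -ρ ≤ ρ)]

omit [Fintype Λ] in
/-- Two fields agreeing on a set of coordinates have clippings agreeing there (lens Sketch15 `clip_congr_on`).
[cite: Balaban1988RG2Cluster, (2.2)–(2.3) p.12] (elementary API for the locality of the potentials) -/
theorem clip_congr_on {ρ : ℝ} {S₀ : Set Λ} {A A' : Λ → ℝ} (h : ∀ b ∈ S₀, A b = A' b) :
    ∀ b ∈ S₀, clip ρ A b = clip ρ A' b := fun b hb => by rw [clip_apply, clip_apply, h b hb]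

omit [Fintype Λ] in
/-- The clipping is continuous (lens Sketch15 `continuous_clip`). [cite: Balaban1987RG1, (2.9) p.266] (elementary API for the small-field box) -/
theorem continuous_clip (ρ : ℝ) : Continuous (clip ρ : (Λ → ℝ) → (Λ → ℝ)) :=
  continuous_pi fun b => continuous_const.max (continuous_const.min (continuous_apply b))

/-- The clipping is measurable (lens Sketch15 `measurable_clip`). [cite: Balaban1987RG1, (2.9) p.266] (elementary API for the small-field box) -/
theorem measurable_clip (ρ : ℝ) : Measurable (clip ρ : (Λ → ℝ) → (Λ → ℝ)) := (continuous_clip ρ).measurable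

/-- `B ↦ clip ρ (s • B)` is measurable (lens Sketch15 `measurable_clip_smul`). [cite: Balaban1987RG1, (2.9)–(2.12) pp.266–267] (elementary API for the small-field box) -/
theorem measurable_clip_smul (ρ s : ℝ) : Measurable (fun B : Λ → ℝ => clip ρ (s • B)) :=
  (measurable_clip ρ).comp (continuous_const_smul s).measurable

/-! ## §2. LOCAL growth letters on the sup-ball ⇒ the GLOBAL letters of `B13CentredExpLetters` §4, for the clipped functions
(lens Sketch15 §G) -/

/-- **(G1) global cubic majorant** for `𝒲^π := 𝒲 ∘ clip ρ` from the LOCAL one on `‖A‖ ≤ ρ` (lens Sketch15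
`cubic_global_of_local`). [cite: Balaban1987RG1, (2.10) p.267; Balaban1988RG2Cluster, (1.20) p.6] -/
theorem cubic_global_of_local {𝒲 : (Λ → ℝ) → ℂ} {ρ c₃ : ℝ} (hρ : 0 ≤ ρ) (hc₃ : 0 ≤ c₃)
    (h : ∀ A, ‖A‖ ≤ ρ → ‖𝒲 A‖ ≤ c₃ * ‖A‖ ^ 3) (A : Λ → ℝ) : ‖𝒲 (clip ρ A)‖ ≤ c₃ * ‖A‖ ^ 3 :=
  (h _ (norm_clip_le hρ A)).trans
    (mul_le_mul_of_nonneg_left (pow_le_pow_left₀ (norm_nonneg _) (norm_clip_le_norm hρ A) 3) hc₃)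

/-- **THE (2.20) LETTER BECOMES GLOBAL WITH THE ON-BOX RATE** (lens Sketch15 `h220_clip_pointwise`): for ALL `B` and ALL
`s > 0`, `‖s⁻²𝒲(clip ρ (sB))‖ ≤ c₃ρ · B·B` — from the LOCAL cubic majorant only (`‖clip X‖ ≤ ρ`, `‖clip X‖ ≤ ‖X‖ = s‖B‖`);
compare `B13CentredExpLetters.h220_unscaled_onBox` (the unclipped law has this rate only on the box).
[cite: Balaban1988RG2Cluster, (2.20) p.16, (1.20) p.6; Balaban1987RG1, (2.9)–(2.10) pp.266–267] -/
theorem h220_clip_pointwise {𝒲 : (Λ → ℝ) → ℂ} {ρ c₃ s : ℝ} (hs : 0 < s) (hρ : 0 ≤ ρ) (hc₃ : 0 ≤ c₃)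
    (h : ∀ A, ‖A‖ ≤ ρ → ‖𝒲 A‖ ≤ c₃ * ‖A‖ ^ 3) (B : Λ → ℝ) :
    ‖((s : ℂ) ^ 2)⁻¹ * 𝒲 (clip ρ (s • B))‖ ≤ c₃ * ρ * (B ⬝ᵥ B) := by
  have hsB : ‖s • B‖ = s * ‖B‖ := by rw [norm_smul, Real.norm_eq_abs, abs_of_pos hs]
  have hc : ‖clip ρ (s • B)‖ ≤ ρ := norm_clip_le hρ _
  have hc' : ‖clip ρ (s • B)‖ ≤ s * ‖B‖ := hsB ▸ norm_clip_le_norm hρ _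
  have hW : ‖𝒲 (clip ρ (s • B))‖ ≤ c₃ * ρ * (s * ‖B‖) ^ 2 := by
    calc ‖𝒲 (clip ρ (s • B))‖ ≤ c₃ * ‖clip ρ (s • B)‖ ^ 3 := h _ hc
      _ = c₃ * (‖clip ρ (s • B)‖ * ‖clip ρ (s • B)‖ ^ 2) := by ring
      _ ≤ c₃ * (ρ * (s * ‖B‖) ^ 2) :=
          mul_le_mul_of_nonneg_left
            (mul_le_mul hc (pow_le_pow_left₀ (norm_nonneg _) hc' 2) (sq_nonneg _) hρ) hc₃
      _ = c₃ * ρ * (s * ‖B‖) ^ 2 := by ring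
  rw [norm_mul, norm_inv, norm_pow, Complex.norm_real, Real.norm_eq_abs, abs_of_pos hs]
  calc (s ^ 2)⁻¹ * ‖𝒲 (clip ρ (s • B))‖ ≤ (s ^ 2)⁻¹ * (c₃ * ρ * (s * ‖B‖) ^ 2) :=
        mul_le_mul_of_nonneg_left hW (by positivity)
    _ = c₃ * ρ * ‖B‖ ^ 2 := by field_simp
    _ ≤ c₃ * ρ * (B ⬝ᵥ B) := mul_le_mul_of_nonneg_left (pi_norm_sq_le_dotProduct B) (mul_nonneg hc₃ hρ)

/-- **(G2) global quartic remainder** for `𝒲^π` against the (unclipped, global) cubic form `𝒲₃` (lens Sketch15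
`quartic_global_of_local`): `‖𝒲(clip ρ A) − 𝒲₃(A)‖ ≤ (c₄ + (c₃ + c₃′)/ρ)·‖A‖⁴` from the LOCAL letters (L1), (L2) and the global
(L3). [cite: Balaban1987RG1, (2.10)–(2.13) pp.267–268] -/
theorem quartic_global_of_local {𝒲 𝒲₃ : (Λ → ℝ) → ℂ} {ρ c₃ c₃' c₄ : ℝ} (hρ : 0 < ρ) (hc₃ : 0 ≤ c₃) (hc₃' : 0 ≤ c₃')
    (hc₄ : 0 ≤ c₄) (h1 : ∀ A, ‖A‖ ≤ ρ → ‖𝒲 A‖ ≤ c₃ * ‖A‖ ^ 3)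
    (h2 : ∀ A, ‖A‖ ≤ ρ → ‖𝒲 A - 𝒲₃ A‖ ≤ c₄ * ‖A‖ ^ 4) (h3 : ∀ A, ‖𝒲₃ A‖ ≤ c₃' * ‖A‖ ^ 3) (A : Λ → ℝ) :
    ‖𝒲 (clip ρ A) - 𝒲₃ A‖ ≤ (c₄ + (c₃ + c₃') / ρ) * ‖A‖ ^ 4 := by
  have hA0 : 0 ≤ ‖A‖ := norm_nonneg _
  have hq : 0 ≤ (c₃ + c₃') / ρ := div_nonneg (add_nonneg hc₃ hc₃') hρ.le
  rcases le_total ‖A‖ ρ with hA | hA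
  · rw [clip_eq_self_of_norm_le hA]
    calc ‖𝒲 A - 𝒲₃ A‖ ≤ c₄ * ‖A‖ ^ 4 := h2 A hA
      _ ≤ (c₄ + (c₃ + c₃') / ρ) * ‖A‖ ^ 4 := mul_le_mul_of_nonneg_right (by linarith) (by positivity)
  · have h3' : ‖A‖ ^ 3 ≤ ‖A‖ ^ 4 / ρ := by
      rw [le_div_iff₀ hρ]
      calc ‖A‖ ^ 3 * ρ ≤ ‖A‖ ^ 3 * ‖A‖ := mul_le_mul_of_nonneg_left hA (by positivity)
        _ = ‖A‖ ^ 4 := by ring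
    calc ‖𝒲 (clip ρ A) - 𝒲₃ A‖ ≤ ‖𝒲 (clip ρ A)‖ + ‖𝒲₃ A‖ := norm_sub_le _ _
      _ ≤ c₃ * ‖A‖ ^ 3 + c₃' * ‖A‖ ^ 3 := add_le_add (cubic_global_of_local hρ.le hc₃ h1 A) (h3 A)
      _ = (c₃ + c₃') * ‖A‖ ^ 3 := by ring
      _ ≤ (c₃ + c₃') * (‖A‖ ^ 4 / ρ) := mul_le_mul_of_nonneg_left h3' (add_nonneg hc₃ hc₃')
      _ = (c₃ + c₃') / ρ * ‖A‖ ^ 4 := by ring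
      _ ≤ (c₄ + (c₃ + c₃') / ρ) * ‖A‖ ^ 4 := mul_le_mul_of_nonneg_right (by linarith) (by positivity)

/-- **(G4) global linear majorant** for `𝒪^π := 𝒪 ∘ clip ρ` from the LOCAL one (lens Sketch15 `linear_global_of_local`):
`‖𝒪(clip ρ A) − 𝒪(clip ρ 0)‖ ≤ c₁‖A‖`. [cite: Balaban1987RG1, (2.12)–(2.13) p.268; Balaban1988RG2Cluster, (1.20) p.6] -/
theorem linear_global_of_local {𝒪 : (Λ → ℝ) → ℂ} {ρ c₁ : ℝ} (hρ : 0 ≤ ρ) (hc₁ : 0 ≤ c₁)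
    (h : ∀ A, ‖A‖ ≤ ρ → ‖𝒪 A - 𝒪 0‖ ≤ c₁ * ‖A‖) (A : Λ → ℝ) :
    ‖𝒪 (clip ρ A) - 𝒪 (clip ρ 0)‖ ≤ c₁ * ‖A‖ := by
  rw [clip_zero hρ]
  exact (h _ (norm_clip_le hρ A)).trans (mul_le_mul_of_nonneg_left (norm_clip_le_norm hρ A) hc₁)

/-- **(G5) global quadratic remainder** for `𝒪^π` against the (unclipped, global) differential `D𝒪` (lens Sketch15
`quadratic_global_of_local`): `‖𝒪(clip ρ A) − 𝒪(clip ρ 0) − D𝒪(A)‖ ≤ (c₂ + (c₁ + c₁′)/ρ)·‖A‖²` from the LOCAL (L4), (L5) and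
the global (L6). [cite: Balaban1987RG1, (2.12)–(2.13) p.268] -/
theorem quadratic_global_of_local {𝒪 D𝒪 : (Λ → ℝ) → ℂ} {ρ c₁ c₁' c₂ : ℝ} (hρ : 0 < ρ) (hc₁ : 0 ≤ c₁)
    (hc₁' : 0 ≤ c₁') (hc₂ : 0 ≤ c₂) (h4 : ∀ A, ‖A‖ ≤ ρ → ‖𝒪 A - 𝒪 0‖ ≤ c₁ * ‖A‖)
    (h5 : ∀ A, ‖A‖ ≤ ρ → ‖𝒪 A - 𝒪 0 - D𝒪 A‖ ≤ c₂ * ‖A‖ ^ 2) (h6 : ∀ A, ‖D𝒪 A‖ ≤ c₁' * ‖A‖) (A : Λ → ℝ) :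
    ‖𝒪 (clip ρ A) - 𝒪 (clip ρ 0) - D𝒪 A‖ ≤ (c₂ + (c₁ + c₁') / ρ) * ‖A‖ ^ 2 := by
  have hA0 : 0 ≤ ‖A‖ := norm_nonneg _
  have hq : 0 ≤ (c₁ + c₁') / ρ := div_nonneg (add_nonneg hc₁ hc₁') hρ.le
  rw [clip_zero hρ.le]
  rcases le_total ‖A‖ ρ with hA | hA
  · rw [clip_eq_self_of_norm_le hA]
    calc ‖𝒪 A - 𝒪 0 - D𝒪 A‖ ≤ c₂ * ‖A‖ ^ 2 := h5 A hA
      _ ≤ (c₂ + (c₁ + c₁') / ρ) * ‖A‖ ^ 2 := mul_le_mul_of_nonneg_right (by linarith) (by positivity)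
  · have h1' : ‖A‖ ≤ ‖A‖ ^ 2 / ρ := by
      rw [le_div_iff₀ hρ]
      calc ‖A‖ * ρ ≤ ‖A‖ * ‖A‖ := mul_le_mul_of_nonneg_left hA hA0
        _ = ‖A‖ ^ 2 := by ring
    calc ‖𝒪 (clip ρ A) - 𝒪 0 - D𝒪 A‖ ≤ ‖𝒪 (clip ρ A) - 𝒪 0‖ + ‖D𝒪 A‖ := norm_sub_le _ _
      _ ≤ c₁ * ‖A‖ + c₁' * ‖A‖ :=
          add_le_add ((h4 _ (norm_clip_le hρ.le A)).trans
            (mul_le_mul_of_nonneg_left (norm_clip_le_norm hρ.le A) hc₁)) (h6 A)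
      _ = (c₁ + c₁') * ‖A‖ := by ring
      _ ≤ (c₁ + c₁') * (‖A‖ ^ 2 / ρ) := mul_le_mul_of_nonneg_left h1' (add_nonneg hc₁ hc₁')
      _ = (c₁ + c₁') / ρ * ‖A‖ ^ 2 := by ring
      _ ≤ (c₂ + (c₁ + c₁') / ρ) * ‖A‖ ^ 2 := mul_le_mul_of_nonneg_right (by linarith) (by positivity)

/-! ## §3. The clipped member, the centre and the odd part; `F214` does not see the clipping; the engines' letters on the
τ-region (lens Sketch15 §V) -/

/-- **The b = 1 member's potentials under the CLIPPED unscaled-field law** (lens Sketch15 `Vclip`):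
`𝐕^π_s(Y,B) := s⁻²𝒲(Y, clip ρ (sB)) + 𝒪(Y, clip ρ (sB))`. [cite: Balaban1987RG1, (2.10)–(2.13) pp.267–268; Balaban1988RG2Cluster, (1.41) p.11] -/
def Vclip (ρ s : ℝ) (𝒲 𝒪 : D → (Λ → ℝ) → ℂ) : D → (Λ → ℝ) → ℂ :=
  fun Y B => ((s : ℂ) ^ 2)⁻¹ * 𝒲 Y (clip ρ (s • B)) + 𝒪 Y (clip ρ (s • B))

/-- The UNclipped law's b = 1 member (lens Sketch15 `Vlaw`): `𝐕_s(Y,B) := s⁻²𝒲(Y, sB) + 𝒪(Y, sB)` (the generic form of the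
unscaled-field law «B = g_kB′»). [cite: Balaban1987RG1, (2.10)–(2.13) pp.267–268] -/
def Vlaw (s : ℝ) (𝒲 𝒪 : D → (Λ → ℝ) → ℂ) : D → (Λ → ℝ) → ℂ :=
  fun Y B => ((s : ℂ) ^ 2)⁻¹ * 𝒲 Y (s • B) + 𝒪 Y (s • B)

omit [Fintype Λ] in
/-- **The centre `𝐕₀ := 𝒪(·, 0)`** (lens Sketch15 `V₀`; the older terms at zero fluctuation field; FIELD-CONSTANT, hence even and
`s`-free). [cite: Balaban1987RG1, (2.13) p.268] -/
def V₀ (𝒪 : D → (Λ → ℝ) → ℂ) : D → (Λ → ℝ) → ℂ := fun Y _ => 𝒪 Y 0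

omit [Fintype Λ] in
/-- **The odd part `𝐕₁ := s(𝒲₃ + D𝒪)`** (lens Sketch15 `V₁`; three-gluon cubic + the older terms' differential).
[cite: Balaban1987RG1, (2.10)–(2.13) pp.267–268] -/
def V₁ (s : ℝ) (𝒲₃ D𝒪 : D → (Λ → ℝ) → ℂ) : D → (Λ → ℝ) → ℂ := fun Y B => (s : ℂ) * (𝒲₃ Y B + D𝒪 Y B)

omit [Fintype Λ] in
/-- The centre is EVEN in the field (`rfl`; lens Sketch15 `V₀_even`) — the engines' `hV₀e` binder. [cite: Balaban1987RG1, (2.13) p.268] (elementary API) -/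
theorem V₀_even (𝒪 : D → (Λ → ℝ) → ℂ) (Y : D) (B : Λ → ℝ) : V₀ 𝒪 Y (-B) = V₀ 𝒪 Y B := rfl

omit [Fintype Λ] in
/-- **`𝐕₁` is odd** from the homogeneity letters (L3)′∕(L6)′ (`𝒲₃(rA) = r³𝒲₃(A)`, `D𝒪(rA) = rD𝒪(A)`; lens Sketch15 `V₁_odd`,
via `B13CentredExpLetters.odd_of_homogeneous`) — the engines' `hV₁o` binder. [cite: Balaban1987RG1, (2.10)–(2.13) pp.267–268] -/
theorem V₁_odd {𝒲₃ D𝒪 : D → (Λ → ℝ) → ℂ} (s : ℝ)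
    (h𝒲₃ : ∀ Y (r : ℝ) A, 𝒲₃ Y (r • A) = (r : ℂ) ^ 3 * 𝒲₃ Y A)
    (hD𝒪 : ∀ Y (r : ℝ) A, D𝒪 Y (r • A) = (r : ℂ) * D𝒪 Y A) (Y : D) (B : Λ → ℝ) :
    V₁ s 𝒲₃ D𝒪 Y (-B) = -V₁ s 𝒲₃ D𝒪 Y B := by
  have h3 : 𝒲₃ Y (-B) = -𝒲₃ Y B := odd_of_homogeneous (n := 3) (by decide) (h𝒲₃ Y) B
  have h1 : D𝒪 Y (-B) = -D𝒪 Y B :=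
    odd_of_homogeneous (n := 1) (by decide) (fun r A => by rw [hD𝒪 Y r A, pow_one]) B
  simp only [V₁, h3, h1]
  ring

/-- `𝐕^π` is measurable in the field when `𝒲(Y,·)`, `𝒪(Y,·)` are (lens Sketch15 `measurable_Vclip`) — the engines' `hVm`
binder. [cite: Balaban1988RG2Cluster, (2.14) p.15] (elementary API for (2.14)) -/
theorem measurable_Vclip {𝒲 𝒪 : D → (Λ → ℝ) → ℂ} (ρ s : ℝ) (h𝒲m : ∀ Y, Measurable (𝒲 Y))
    (h𝒪m : ∀ Y, Measurable (𝒪 Y)) (Y : D) : Measurable (Vclip ρ s 𝒲 𝒪 Y) :=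
  (((h𝒲m Y).comp (measurable_clip_smul ρ s)).const_mul _).add ((h𝒪m Y).comp (measurable_clip_smul ρ s))

omit [Fintype Λ] in
/-- `𝐕₀` is measurable (constant in the field; lens Sketch15 `measurable_V₀`) — the engines' `hV₀m` binder.
[cite: Balaban1988RG2Cluster, (2.14) p.15] (elementary API for (2.14)) -/
theorem measurable_V₀ (𝒪 : D → (Λ → ℝ) → ℂ) (Y : D) : Measurable (V₀ 𝒪 Y) := measurable_const

omit [Fintype Λ] in
/-- `𝐕₁` is measurable when `𝒲₃(Y,·)`, `D𝒪(Y,·)` are (lens Sketch15 `measurable_V₁`) — the engines' `hV₁m` binder.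
[cite: Balaban1988RG2Cluster, (2.14) p.15] (elementary API for (2.14)) -/
theorem measurable_V₁ {𝒲₃ D𝒪 : D → (Λ → ℝ) → ℂ} (s : ℝ) (h𝒲₃m : ∀ Y, Measurable (𝒲₃ Y))
    (hD𝒪m : ∀ Y, Measurable (D𝒪 Y)) (Y : D) : Measurable (V₁ s 𝒲₃ D𝒪 Y) :=
  ((h𝒲₃m Y).add (hD𝒪m Y)).const_mul _

omit [Fintype Λ] in
/-- **`F214` reads the potentials only on the support of `χ_{Y₀}`** (lens Sketch15 `F214_congr_on_support`): two potential families
agreeing there (for `Y ∈ 𝐃`) give the same (2.14) last line, for every `τ` and every `B`.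
[cite: Balaban1988RG2Cluster, (2.14) p.15, (2.2)–(2.3) p.12] -/
theorem F214_congr_on_support {V V' : D → (Λ → ℝ) → ℂ} (cardP : ℕ) (χY₀ χcP : (Λ → ℝ) → ℝ) (Dfam : Finset D)
    (h : ∀ B, χY₀ B ≠ 0 → ∀ Y ∈ Dfam, V Y B = V' Y B) (τ : D → ℂ) (B : Λ → ℝ) :
    F214 cardP χY₀ χcP Dfam V τ B = F214 cardP χY₀ χcP Dfam V' τ B := by
  by_cases hχ : χY₀ B = 0
  · simp [F214, hχ]
  · have hsum : ∑ Y ∈ Dfam, τ Y * V Y B = ∑ Y ∈ Dfam, τ Y * V' Y B :=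
      Finset.sum_congr rfl fun Y hY => by rw [h B hχ Y hY]
    simp only [F214, hsum]

omit [Fintype Λ] in
/-- **The clipped and the unclipped member agree on the support of the box** (coordinatewise device + locality; lens Sketch15
`Vclip_eq_Vlaw_on_support`): if `χ_{Y₀}` at the coupling forces `|s·B(b)| ≤ ρ` on a set of bonds `S₀` (those of `Y₀`), and
`𝒲(Y,·)`, `𝒪(Y,·)`, `Y ∈ 𝐃`, read only `S₀`-coordinates (`Y ⊂ Y₀`), then `χ_{Y₀}(B) ≠ 0 → 𝐕^π_s(Y,B) = 𝐕_s(Y,B)`.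
[cite: Balaban1988RG2Cluster, (2.2)–(2.3) p.12; Balaban1987RG1, (2.9) p.266] -/
theorem Vclip_eq_Vlaw_on_support {𝒲 𝒪 : D → (Λ → ℝ) → ℂ} {ρ s : ℝ} (χY₀ : (Λ → ℝ) → ℝ) (Dfam : Finset D) (S₀ : Set Λ)
    (hbox : ∀ B, χY₀ B ≠ 0 → ∀ b ∈ S₀, |(s • B) b| ≤ ρ)
    (hloc𝒲 : ∀ Y ∈ Dfam, ∀ A A' : Λ → ℝ, (∀ b ∈ S₀, A b = A' b) → 𝒲 Y A = 𝒲 Y A')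
    (hloc𝒪 : ∀ Y ∈ Dfam, ∀ A A' : Λ → ℝ, (∀ b ∈ S₀, A b = A' b) → 𝒪 Y A = 𝒪 Y A') :
    ∀ B, χY₀ B ≠ 0 → ∀ Y ∈ Dfam, Vclip ρ s 𝒲 𝒪 Y B = Vlaw s 𝒲 𝒪 Y B := by
  intro B hχ Y hY
  have hagree : ∀ b ∈ S₀, clip ρ (s • B) b = (s • B) b := fun b hb => clip_apply_of_abs_le (hbox B hχ b hb)
  simp only [Vclip, Vlaw, hloc𝒲 Y hY _ _ hagree, hloc𝒪 Y hY _ _ hagree]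

omit [Fintype Λ] in
/-- **`F214` DOES NOT SEE THE CLIPPING** (the coordinatewise device is exact on the support; lens Sketch15 `F214_clip_eq`): under
the box-support and locality hypotheses of `Vclip_eq_Vlaw_on_support`, `F214(𝐕^π) = F214(𝐕)` for every `τ` and every `B` — so
the clipped twin generates the SAME (2.14) last line, `X`-integral and term.  The large coordinates on `P ⊂ Y₀ᶜ` and the free ones
on `Z₀ ∖ (Y₀ ∪ P)` are not read by `𝐕`; a RADIAL projection of the whole `B` would be wrong there.
[cite: Balaban1988RG2Cluster, (2.2)–(2.3) p.12, (2.14) p.15; Balaban1987RG1, (2.9) p.266] -/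
theorem F214_clip_eq {𝒲 𝒪 : D → (Λ → ℝ) → ℂ} {ρ s : ℝ} (cardP : ℕ) (χY₀ χcP : (Λ → ℝ) → ℝ) (Dfam : Finset D)
    (S₀ : Set Λ) (hbox : ∀ B, χY₀ B ≠ 0 → ∀ b ∈ S₀, |(s • B) b| ≤ ρ)
    (hloc𝒲 : ∀ Y ∈ Dfam, ∀ A A' : Λ → ℝ, (∀ b ∈ S₀, A b = A' b) → 𝒲 Y A = 𝒲 Y A')
    (hloc𝒪 : ∀ Y ∈ Dfam, ∀ A A' : Λ → ℝ, (∀ b ∈ S₀, A b = A' b) → 𝒪 Y A = 𝒪 Y A')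
    (τ : D → ℂ) (B : Λ → ℝ) :
    F214 cardP χY₀ χcP Dfam (Vclip ρ s 𝒲 𝒪) τ B = F214 cardP χY₀ χcP Dfam (Vlaw s 𝒲 𝒪) τ B :=
  F214_congr_on_support cardP χY₀ χcP Dfam (Vclip_eq_Vlaw_on_support χY₀ Dfam S₀ hbox hloc𝒲 hloc𝒪) τ B

omit [Fintype Λ] in
/-- **Member level** (window-dilated family with UNDILATED boxes, powers `(b², b, 1)` on (remainder, odd part, centre); lens
Sketch15 `member_congr_on_support`): the member potentials built from the clipped twin agree with those built from the unclipped law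
on the support of `χ_{Y₀}`, hence give the same `F214` for every complex `b` (apply `F214_congr_on_support`).
[cite: Balaban1988RG2Cluster, (2.14) p.15] (elementary API for (2.14)) -/
theorem member_congr_on_support {V V' V₀' V₁' : D → (Λ → ℝ) → ℂ} (χY₀ : (Λ → ℝ) → ℝ) (Dfam : Finset D) (b : ℂ)
    (h : ∀ B, χY₀ B ≠ 0 → ∀ Y ∈ Dfam, V Y B = V' Y B) :
    ∀ B, χY₀ B ≠ 0 → ∀ Y ∈ Dfam,
      V₀' Y B + b * V₁' Y B + b ^ 2 * (V Y B - V₀' Y B - V₁' Y B)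
        = V₀' Y B + b * V₁' Y B + b ^ 2 * (V' Y B - V₀' Y B - V₁' Y B) :=
  fun B hχ Y hY => by rw [h B hχ Y hY]

/-- On the box in the sup norm the two members agree pointwise (no locality needed; lens Sketch15 `Vclip_eq_Vlaw_of_norm_le`):
`‖sB‖ ≤ ρ → 𝐕^π_s(Y,B) = 𝐕_s(Y,B)`. [cite: Balaban1987RG1, (2.9) p.266] (elementary API for the small-field box) -/
theorem Vclip_eq_Vlaw_of_norm_le {𝒲 𝒪 : D → (Λ → ℝ) → ℂ} {ρ s : ℝ} (Y : D) {B : Λ → ℝ} (h : ‖s • B‖ ≤ ρ) :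
    Vclip ρ s 𝒲 𝒪 Y B = Vlaw s 𝒲 𝒪 Y B := by
  simp only [Vclip, Vlaw, clip_eq_self_of_norm_le h]

omit [Fintype Λ] in
/-- **The centre's letter `hw₀U`** on a bounded per-domain τ-region (lens Sketch15 `hw₀U_clip`): `Σ_Y |τ Y|·‖𝐕₀(Y,B)‖ ≤ R·|𝐃|·c₀`
from (L0) `‖𝒪(Y,0)‖ ≤ c₀` — the shape of `B13Bound226CentredRem.h226_torus_windowDilated_centred_of_primitives_exp`'s `hw₀U`.
[cite: Balaban1988RG2Cluster, (2.14) p.15, (2.20) p.16; Balaban1987RG1, (2.13) p.268] -/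
theorem hw₀U_clip {𝒪 : D → (Λ → ℝ) → ℂ} (Dfam : Finset D) (Uτ : D → Set ℂ) {R c₀ : ℝ} (hR : 0 ≤ R)
    (hUτ : ∀ Y ∈ Dfam, ∀ z ∈ Uτ Y, ‖z‖ ≤ R) (h0 : ∀ Y ∈ Dfam, ‖𝒪 Y 0‖ ≤ c₀) :
    ∀ τ : D → ℂ, (∀ Y, τ Y ∈ Uτ Y) → ∀ B : Λ → ℝ,
      ∑ Y ∈ Dfam, ‖τ Y‖ * ‖V₀ 𝒪 Y B‖ ≤ R * Dfam.card * c₀ := by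
  intro τ hτ B
  have hE : ∀ Y ∈ Dfam, ‖τ Y‖ * ‖V₀ 𝒪 Y B‖ ≤ R * c₀ := fun Y hY =>
    mul_le_mul (hUτ Y hY _ (hτ Y)) (h0 Y hY) (norm_nonneg _) hR
  calc ∑ Y ∈ Dfam, ‖τ Y‖ * ‖V₀ 𝒪 Y B‖ ≤ ∑ Y ∈ Dfam, R * c₀ := Finset.sum_le_sum hE
    _ = R * Dfam.card * c₀ := by rw [Finset.sum_const, nsmul_eq_mul]; ring

/-- **THE (2.20) LETTER `h220U` FOR THE CLIPPED MEMBER, GLOBAL IN `B`, SMALL RATE** (lens Sketch15 `h220U_clip`): on a bounded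
per-domain τ-region, for every `s > 0` and EVERY `B`, `Σ_Y |τ Y|·‖𝐕^π_s(Y,B)‖ ≤ ½(2R|𝐃|c₃ρ)·B·B + R|𝐃|(c₀ + c₁ρ)` — from the
LOCAL letters (L0), (L1), (L4) only.  The rate `a₂₀ = 2R|𝐃|c₃ρ` is as small as the clipping radius `ρ = O(1)ε₁`; without the
clipping no such global letter exists (`B13CentredExpLetters.linLetter_fails_cubic` ∕ `h220_unscaled_onBox`).
[cite: Balaban1988RG2Cluster, (2.20) p.16, (1.20) p.6, (2.14) p.15; Balaban1987RG1, (2.9)–(2.13) pp.266–268] -/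
theorem h220U_clip {𝒲 𝒪 : D → (Λ → ℝ) → ℂ} (Dfam : Finset D) (Uτ : D → Set ℂ) {R ρ c₀ c₁ c₃ s : ℝ} (hs : 0 < s)
    (hR : 0 ≤ R) (hρ : 0 ≤ ρ) (hc₃ : 0 ≤ c₃) (hc₁ : 0 ≤ c₁)
    (hUτ : ∀ Y ∈ Dfam, ∀ z ∈ Uτ Y, ‖z‖ ≤ R) (h0 : ∀ Y ∈ Dfam, ‖𝒪 Y 0‖ ≤ c₀)
    (h1 : ∀ Y ∈ Dfam, ∀ A, ‖A‖ ≤ ρ → ‖𝒲 Y A‖ ≤ c₃ * ‖A‖ ^ 3)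
    (h4 : ∀ Y ∈ Dfam, ∀ A, ‖A‖ ≤ ρ → ‖𝒪 Y A - 𝒪 Y 0‖ ≤ c₁ * ‖A‖) :
    ∀ τ : D → ℂ, (∀ Y, τ Y ∈ Uτ Y) → ∀ B : Λ → ℝ,
      ∑ Y ∈ Dfam, ‖τ Y‖ * ‖Vclip ρ s 𝒲 𝒪 Y B‖
        ≤ (2 * R * Dfam.card * c₃ * ρ) / 2 * (B ⬝ᵥ B) + R * Dfam.card * (c₀ + c₁ * ρ) := by
  intro τ hτ B
  have hBB : 0 ≤ B ⬝ᵥ B := Finset.sum_nonneg fun i _ => mul_self_nonneg (B i)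
  have hE : ∀ Y ∈ Dfam, ‖τ Y‖ * ‖Vclip ρ s 𝒲 𝒪 Y B‖ ≤ R * (c₃ * ρ * (B ⬝ᵥ B) + (c₀ + c₁ * ρ)) := by
    intro Y hY
    refine mul_le_mul (hUτ Y hY _ (hτ Y)) ?_ (norm_nonneg _) hR
    have hO : ‖𝒪 Y (clip ρ (s • B))‖ ≤ c₀ + c₁ * ρ := by
      have hd : ‖𝒪 Y (clip ρ (s • B)) - 𝒪 Y 0‖ ≤ c₁ * ρ :=
        (h4 Y hY _ (norm_clip_le hρ _)).trans (mul_le_mul_of_nonneg_left (norm_clip_le hρ _) hc₁)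
      calc ‖𝒪 Y (clip ρ (s • B))‖ = ‖𝒪 Y 0 + (𝒪 Y (clip ρ (s • B)) - 𝒪 Y 0)‖ := by rw [add_sub_cancel]
        _ ≤ ‖𝒪 Y 0‖ + ‖𝒪 Y (clip ρ (s • B)) - 𝒪 Y 0‖ := norm_add_le _ _
        _ ≤ c₀ + c₁ * ρ := add_le_add (h0 Y hY) hd
    calc ‖Vclip ρ s 𝒲 𝒪 Y B‖ ≤ ‖((s : ℂ) ^ 2)⁻¹ * 𝒲 Y (clip ρ (s • B))‖ + ‖𝒪 Y (clip ρ (s • B))‖ := norm_add_le _ _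
      _ ≤ c₃ * ρ * (B ⬝ᵥ B) + (c₀ + c₁ * ρ) := add_le_add (h220_clip_pointwise hs hρ hc₃ (h1 Y hY) B) hO
  calc ∑ Y ∈ Dfam, ‖τ Y‖ * ‖Vclip ρ s 𝒲 𝒪 Y B‖
      ≤ ∑ Y ∈ Dfam, R * (c₃ * ρ * (B ⬝ᵥ B) + (c₀ + c₁ * ρ)) := Finset.sum_le_sum hE
    _ = (2 * R * Dfam.card * c₃ * ρ) / 2 * (B ⬝ᵥ B) + R * Dfam.card * (c₀ + c₁ * ρ) := by
        rw [Finset.sum_const, nsmul_eq_mul]; ring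

/-! ## §4. The bridges to `B13CentredExpLetters` §4 and the exponential Taylor letters of the clipped twin
(lens Sketch15 §B + two compositions) -/

omit [Fintype Λ] in
/-- `𝐕^π − 𝐕₀` in `B13CentredExpLetters.firstOrder_unscaled`'s shape (`𝒪^π(Y,0) = 𝒪(Y, clip ρ 0) = 𝒪(Y,0)`; lens Sketch15
`Vclip_sub_V₀`). [cite: Balaban1987RG1, (2.10)–(2.13) pp.267–268] (elementary API) -/
theorem Vclip_sub_V₀ {𝒲 𝒪 : D → (Λ → ℝ) → ℂ} {ρ : ℝ} (hρ : 0 ≤ ρ) (s : ℝ) (Y : D) (B : Λ → ℝ) :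
    Vclip ρ s 𝒲 𝒪 Y B - V₀ 𝒪 Y B
      = ((s : ℂ) ^ 2)⁻¹ * (fun A => 𝒲 Y (clip ρ A)) (s • B) + (fun A => 𝒪 Y (clip ρ A)) (s • B)
          - (fun A => 𝒪 Y (clip ρ A)) 0 := by
  simp only [Vclip, V₀, clip_zero hρ]

omit [Fintype Λ] in
/-- `𝐕^π − 𝐕₀ − 𝐕₁` in `B13CentredExpLetters.secondOrder_unscaled`'s shape (lens Sketch15 `Vclip_sub_V₀_sub_V₁`).
[cite: Balaban1987RG1, (2.10)–(2.13) pp.267–268] (elementary API) -/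
theorem Vclip_sub_V₀_sub_V₁ {𝒲 𝒲₃ 𝒪 D𝒪 : D → (Λ → ℝ) → ℂ} {ρ : ℝ} (hρ : 0 ≤ ρ) (s : ℝ) (Y : D) (B : Λ → ℝ) :
    Vclip ρ s 𝒲 𝒪 Y B - V₀ 𝒪 Y B - V₁ s 𝒲₃ D𝒪 Y B
      = ((s : ℂ) ^ 2)⁻¹ * (fun A => 𝒲 Y (clip ρ A)) (s • B) + (fun A => 𝒪 Y (clip ρ A)) (s • B)
          - (fun A => 𝒪 Y (clip ρ A)) 0 - (s : ℂ) * (𝒲₃ Y B + D𝒪 Y B) := by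
  simp only [Vclip, V₀, V₁, clip_zero hρ]

/-- **The four GLOBAL growth letters of `B13CentredExpLetters` §4 for the clipped functions, bundled** (uniform over `Y ∈ 𝐃`;
lens Sketch15 `globalLetters_of_local`): from the LOCAL letters (L1), (L2), (L4), (L5) on the sup-ball of radius `ρ > 0` and the
global homogeneous-part letters (L3), (L6), the functions `𝒲^π(Y,·)`, `𝒪^π(Y,·)` satisfy the `h𝒲`, `h𝒪` binders of
`firstOrder∕secondOrder_unscaled_gauss` with the constants `c₃`, `c₁`, `c₄ + (c₃+c₃′)/ρ`, `c₂ + (c₁+c₁′)/ρ`.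
[cite: Balaban1987RG1, (2.10)–(2.13) pp.267–268; Balaban1988RG2Cluster, (1.20) p.6, (2.20) p.16] -/
theorem globalLetters_of_local {𝒲 𝒲₃ 𝒪 D𝒪 : D → (Λ → ℝ) → ℂ} (Dfam : Finset D) {ρ c₃ c₃' c₄ c₁ c₁' c₂ : ℝ}
    (hρ : 0 < ρ) (hc₃ : 0 ≤ c₃) (hc₃' : 0 ≤ c₃') (hc₄ : 0 ≤ c₄) (hc₁ : 0 ≤ c₁) (hc₁' : 0 ≤ c₁') (hc₂ : 0 ≤ c₂)
    (h1 : ∀ Y ∈ Dfam, ∀ A, ‖A‖ ≤ ρ → ‖𝒲 Y A‖ ≤ c₃ * ‖A‖ ^ 3)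
    (h2 : ∀ Y ∈ Dfam, ∀ A, ‖A‖ ≤ ρ → ‖𝒲 Y A - 𝒲₃ Y A‖ ≤ c₄ * ‖A‖ ^ 4)
    (h3 : ∀ Y ∈ Dfam, ∀ A, ‖𝒲₃ Y A‖ ≤ c₃' * ‖A‖ ^ 3)
    (h4 : ∀ Y ∈ Dfam, ∀ A, ‖A‖ ≤ ρ → ‖𝒪 Y A - 𝒪 Y 0‖ ≤ c₁ * ‖A‖)
    (h5 : ∀ Y ∈ Dfam, ∀ A, ‖A‖ ≤ ρ → ‖𝒪 Y A - 𝒪 Y 0 - D𝒪 Y A‖ ≤ c₂ * ‖A‖ ^ 2)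
    (h6 : ∀ Y ∈ Dfam, ∀ A, ‖D𝒪 Y A‖ ≤ c₁' * ‖A‖) :
    (∀ Y ∈ Dfam, ∀ A, ‖𝒲 Y (clip ρ A)‖ ≤ c₃ * ‖A‖ ^ 3) ∧
    (∀ Y ∈ Dfam, ∀ A, ‖𝒲 Y (clip ρ A) - 𝒲₃ Y A‖ ≤ (c₄ + (c₃ + c₃') / ρ) * ‖A‖ ^ 4) ∧
    (∀ Y ∈ Dfam, ∀ A, ‖𝒪 Y (clip ρ A) - 𝒪 Y (clip ρ 0)‖ ≤ c₁ * ‖A‖) ∧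
    (∀ Y ∈ Dfam, ∀ A, ‖𝒪 Y (clip ρ A) - 𝒪 Y (clip ρ 0) - D𝒪 Y A‖ ≤ (c₂ + (c₁ + c₁') / ρ) * ‖A‖ ^ 2) :=
  ⟨fun Y hY A => cubic_global_of_local hρ.le hc₃ (h1 Y hY) A,
   fun Y hY A => quartic_global_of_local hρ hc₃ hc₃' hc₄ (h1 Y hY) (h2 Y hY) (h3 Y hY) A,
   fun Y hY A => linear_global_of_local hρ.le hc₁ (h4 Y hY) A,
   fun Y hY A => quadratic_global_of_local hρ hc₁ hc₁' hc₂ (h4 Y hY) (h5 Y hY) (h6 Y hY) A⟩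

/-- **THE FIRST EXPONENTIAL TAYLOR LETTER `h1eU` OF THE CLIPPED TWIN, `s`-FREE constant, any rate `δ > 0`** (composition typed
here: §2 (G1)∕(G4) fed to `B13CentredExpLetters.firstOrder_unscaled_gauss`, summed over `Y ∈ 𝐃` on a bounded τ-region): for every
`s > 0` and EVERY `B`, `Σ_Y |τ Y|·‖𝐕^π_s(Y,B) − 𝐕₀(Y,B)‖ ≤ s·[R·|𝐃|·(c₃(3/(eδ))³ + c₁/(eδ))e^{δ/2}]·e^{½δ B·B}` — the shape of
`B13Bound226CentredRem.h226_torus_windowDilated_centred_of_primitives_exp`'s `h1eU`, from the LOCAL letters (L1), (L4) only.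
[cite: Balaban1987RG1, (2.10)–(2.13) pp.267–268; Balaban1988RG2Cluster, (2.14) p.15, (2.20) p.16, (1.20) p.6] -/
theorem h1eU_clip {𝒲 𝒪 : D → (Λ → ℝ) → ℂ} (Dfam : Finset D) (Uτ : D → Set ℂ) {R ρ c₃ c₁ s δ : ℝ}
    (hs : 0 < s) (hδ : 0 < δ) (hR : 0 ≤ R) (hρ : 0 ≤ ρ) (hc₃ : 0 ≤ c₃) (hc₁ : 0 ≤ c₁)
    (hUτ : ∀ Y ∈ Dfam, ∀ z ∈ Uτ Y, ‖z‖ ≤ R)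
    (h1 : ∀ Y ∈ Dfam, ∀ A, ‖A‖ ≤ ρ → ‖𝒲 Y A‖ ≤ c₃ * ‖A‖ ^ 3)
    (h4 : ∀ Y ∈ Dfam, ∀ A, ‖A‖ ≤ ρ → ‖𝒪 Y A - 𝒪 Y 0‖ ≤ c₁ * ‖A‖) :
    ∀ τ : D → ℂ, (∀ Y, τ Y ∈ Uτ Y) → ∀ B : Λ → ℝ,
      ∑ Y ∈ Dfam, ‖τ Y‖ * ‖Vclip ρ s 𝒲 𝒪 Y B - V₀ 𝒪 Y B‖
        ≤ s * ((R * Dfam.card * ((c₃ * (3 / (Real.exp 1 * δ)) ^ 3 + c₁ * (1 / (Real.exp 1 * δ))) * Real.exp (δ / 2)))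
            * Real.exp (δ / 2 * (B ⬝ᵥ B))) := by
  intro τ hτ B
  set K : ℝ := (c₃ * (3 / (Real.exp 1 * δ)) ^ 3 + c₁ * (1 / (Real.exp 1 * δ))) * Real.exp (δ / 2) with hK
  have hE : ∀ Y ∈ Dfam, ‖τ Y‖ * ‖Vclip ρ s 𝒲 𝒪 Y B - V₀ 𝒪 Y B‖ ≤ R * (s * (K * Real.exp (δ / 2 * (B ⬝ᵥ B)))) := by
    intro Y hY
    have h𝒲π : ∀ A, ‖(fun A => 𝒲 Y (clip ρ A)) A‖ ≤ c₃ * ‖A‖ ^ 3 := fun A => cubic_global_of_local hρ hc₃ (h1 Y hY) A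
    have h𝒪π : ∀ A, ‖(fun A => 𝒪 Y (clip ρ A)) A - (fun A => 𝒪 Y (clip ρ A)) 0‖ ≤ c₁ * ‖A‖ :=
      fun A => linear_global_of_local hρ hc₁ (h4 Y hY) A
    have h := firstOrder_unscaled_gauss hs hδ hc₃ hc₁ h𝒲π h𝒪π B
    rw [← Vclip_sub_V₀ hρ s Y B] at h
    exact mul_le_mul (hUτ Y hY _ (hτ Y)) h (norm_nonneg _) hR
  calc ∑ Y ∈ Dfam, ‖τ Y‖ * ‖Vclip ρ s 𝒲 𝒪 Y B - V₀ 𝒪 Y B‖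
      ≤ ∑ Y ∈ Dfam, R * (s * (K * Real.exp (δ / 2 * (B ⬝ᵥ B)))) := Finset.sum_le_sum hE
    _ = _ := by rw [Finset.sum_const, nsmul_eq_mul]; ring

/-- **THE SECOND EXPONENTIAL TAYLOR LETTER `h2eU` OF THE CLIPPED TWIN, `s`-FREE constant, any rate `δ > 0`** (composition typed
here: §2 (G2)∕(G5) — against the UNclipped homogeneous parts `𝒲₃`, `D𝒪` — fed to `B13CentredExpLetters.secondOrder_unscaled_gauss`):
for every `s > 0` and EVERY `B`,
`Σ_Y |τ Y|·‖𝐕^π_s(Y,B) − 𝐕₀(Y,B) − 𝐕₁(Y,B)‖ ≤ s²·[R·|𝐃|·((c₄+(c₃+c₃′)/ρ)(4/(eδ))⁴ + (c₂+(c₁+c₁′)/ρ)(2/(eδ))²)e^{δ/2}]·e^{½δ B·B}` —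
the shape of `B13Bound226CentredRem.h226_torus_windowDilated_centred_of_primitives_exp`'s `h2eU`, from the LOCAL letters (L1),
(L2), (L4), (L5), the global (L3), (L6) and the homogeneities (L3)′, (L6)′.
[cite: Balaban1987RG1, (2.10)–(2.13) pp.267–268; Balaban1988RG2Cluster, (2.14) p.15, (2.20) p.16, (1.20) p.6] -/
theorem h2eU_clip {𝒲 𝒲₃ 𝒪 D𝒪 : D → (Λ → ℝ) → ℂ} (Dfam : Finset D) (Uτ : D → Set ℂ)
    {R ρ c₃ c₃' c₄ c₁ c₁' c₂ s δ : ℝ} (hs : 0 < s) (hδ : 0 < δ) (hR : 0 ≤ R) (hρ : 0 < ρ)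
    (hc₃ : 0 ≤ c₃) (hc₃' : 0 ≤ c₃') (hc₄ : 0 ≤ c₄) (hc₁ : 0 ≤ c₁) (hc₁' : 0 ≤ c₁') (hc₂ : 0 ≤ c₂)
    (hUτ : ∀ Y ∈ Dfam, ∀ z ∈ Uτ Y, ‖z‖ ≤ R)
    (h1 : ∀ Y ∈ Dfam, ∀ A, ‖A‖ ≤ ρ → ‖𝒲 Y A‖ ≤ c₃ * ‖A‖ ^ 3)
    (h2 : ∀ Y ∈ Dfam, ∀ A, ‖A‖ ≤ ρ → ‖𝒲 Y A - 𝒲₃ Y A‖ ≤ c₄ * ‖A‖ ^ 4)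
    (h3 : ∀ Y ∈ Dfam, ∀ A, ‖𝒲₃ Y A‖ ≤ c₃' * ‖A‖ ^ 3)
    (h𝒲₃ : ∀ Y (r : ℝ) A, 𝒲₃ Y (r • A) = (r : ℂ) ^ 3 * 𝒲₃ Y A)
    (h4 : ∀ Y ∈ Dfam, ∀ A, ‖A‖ ≤ ρ → ‖𝒪 Y A - 𝒪 Y 0‖ ≤ c₁ * ‖A‖)
    (h5 : ∀ Y ∈ Dfam, ∀ A, ‖A‖ ≤ ρ → ‖𝒪 Y A - 𝒪 Y 0 - D𝒪 Y A‖ ≤ c₂ * ‖A‖ ^ 2)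
    (h6 : ∀ Y ∈ Dfam, ∀ A, ‖D𝒪 Y A‖ ≤ c₁' * ‖A‖)
    (hD𝒪 : ∀ Y (r : ℝ) A, D𝒪 Y (r • A) = (r : ℂ) * D𝒪 Y A) :
    ∀ τ : D → ℂ, (∀ Y, τ Y ∈ Uτ Y) → ∀ B : Λ → ℝ,
      ∑ Y ∈ Dfam, ‖τ Y‖ * ‖Vclip ρ s 𝒲 𝒪 Y B - V₀ 𝒪 Y B - V₁ s 𝒲₃ D𝒪 Y B‖
        ≤ s ^ 2 * ((R * Dfam.card * (((c₄ + (c₃ + c₃') / ρ) * (4 / (Real.exp 1 * δ)) ^ 4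
              + (c₂ + (c₁ + c₁') / ρ) * (2 / (Real.exp 1 * δ)) ^ 2) * Real.exp (δ / 2)))
            * Real.exp (δ / 2 * (B ⬝ᵥ B))) := by
  intro τ hτ B
  obtain ⟨hG1, hG2, hG4, hG5⟩ :=
    globalLetters_of_local Dfam hρ hc₃ hc₃' hc₄ hc₁ hc₁' hc₂ h1 h2 h3 h4 h5 h6
  have hc₄' : 0 ≤ c₄ + (c₃ + c₃') / ρ := add_nonneg hc₄ (div_nonneg (add_nonneg hc₃ hc₃') hρ.le)
  have hc₂' : 0 ≤ c₂ + (c₁ + c₁') / ρ := add_nonneg hc₂ (div_nonneg (add_nonneg hc₁ hc₁') hρ.le)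
  set K : ℝ := ((c₄ + (c₃ + c₃') / ρ) * (4 / (Real.exp 1 * δ)) ^ 4
      + (c₂ + (c₁ + c₁') / ρ) * (2 / (Real.exp 1 * δ)) ^ 2) * Real.exp (δ / 2) with hK
  have hE : ∀ Y ∈ Dfam, ‖τ Y‖ * ‖Vclip ρ s 𝒲 𝒪 Y B - V₀ 𝒪 Y B - V₁ s 𝒲₃ D𝒪 Y B‖
      ≤ R * (s ^ 2 * (K * Real.exp (δ / 2 * (B ⬝ᵥ B)))) := by
    intro Y hY
    have h𝒲π : ∀ A, ‖(fun A => 𝒲 Y (clip ρ A)) A - 𝒲₃ Y A‖ ≤ (c₄ + (c₃ + c₃') / ρ) * ‖A‖ ^ 4 :=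
      fun A => hG2 Y hY A
    have h𝒪π : ∀ A, ‖(fun A => 𝒪 Y (clip ρ A)) A - (fun A => 𝒪 Y (clip ρ A)) 0 - D𝒪 Y A‖
        ≤ (c₂ + (c₁ + c₁') / ρ) * ‖A‖ ^ 2 := fun A => hG5 Y hY A
    have h := secondOrder_unscaled_gauss hs hδ hc₄' hc₂' h𝒲π (h𝒲₃ Y) h𝒪π (hD𝒪 Y) B
    rw [← Vclip_sub_V₀_sub_V₁ hρ.le s Y B] at h
    exact mul_le_mul (hUτ Y hY _ (hτ Y)) h (norm_nonneg _) hR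
  calc ∑ Y ∈ Dfam, ‖τ Y‖ * ‖Vclip ρ s 𝒲 𝒪 Y B - V₀ 𝒪 Y B - V₁ s 𝒲₃ D𝒪 Y B‖
      ≤ ∑ Y ∈ Dfam, R * (s ^ 2 * (K * Real.exp (δ / 2 * (B ⬝ᵥ B)))) := Finset.sum_le_sum hE
    _ = _ := by rw [Finset.sum_const, nsmul_eq_mul]; ring

end Literature.MathematicalPhysics.QuantumFieldTheory.Balaban1983to89.B13ClippedFieldLetters

end
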